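import Literature.NumberTheory.Automorphic.MirabolicTowerInvariance
import Literature.NumberTheory.Automorphic.AutomorphicRepsGL
import HarnessLib

/-!
# Block constant terms in box coordinates: the cusp invariant of the Fourier–Whittaker tower
(Cogdell, *Analytic theory of L-functions for GL_n* (2004), §1.1, proof of Thm. 1.1; Borel–Jacquet
(1979), §4.4: constant terms along the unipotent radicals `N_k = 1 + 𝔫_k` of the maximal parabolics)

Topic `NumberTheory/Automorphic`; namespace `Literature.NumberTheory.Automorphic`. Infrastructure for
the lower stages of the mean-square Fourier–Whittaker tower (`MirabolicFourierStage`,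
`ColumnCuspCondition`, `MirabolicTowerInvariance`). The vanishing of the `ξ = 0` column coefficient
needed by the stage identity at column size `c` is the vanishing of a constant term of the previous
coefficient `Φ` along the block `𝔫_c` *of the corner `GL_{c+1}`*; the invariant that propagates down
the tower is "all block constant terms of `Φ` inside the corner `GL_{c+1}` vanish" (`TowerCusp`). This
file sets up these block constant terms **in explicit box coordinates** — functions on the index set
`BlockIdx m k = {(i, j) : i < k ≤ j < m}` with Tate's box `D^{BlockIdx m k}` and any additive Haar
measure — and proves the top case from the tree's `CuspConditionGL`:

* `BlockIdx m k`, `blockMatrixEquiv m k : (BlockIdx m k → R) ≃+ blockNilpotent m k R` (**definitions**;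
  the box coordinates of the block `𝔫_k ≤ M_m(R)` of `GLnCuspidalSpectrum`), continuity both ways
  (`blockMatrixHomeomorph`), `blockMatrixEquiv_mem_rationalBlock_iff` (lattices correspond);
* `isAddHaarMeasure_map_blockMatrixEquiv`, `isAddFundamentalDomain_image_blockMatrixEquiv` — transport
  of Haar measures and of Tate's box fundamental domain (as in `ColumnCuspCondition`, for the full block);
* `glCorner_refl` — `diag(g, 1_0) = g`;
* `setIntegral_piFundamentalDomain_comp_add` — **translation invariance of box integrals of periodic
  functions**: `∫_{D^ι} F(v + s) dν = ∫_{D^ι} F(v) dν` for `F` continuous and `K^ι`-periodic (descent to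
  the compact group `𝔸_K^ι ⧸ K^ι`; Tate's Lemma 4.2.1) — the only "shear" input of the inductive step;
* `blockCT hc k ν φ y = ∫_{D} φ(diag(1 + N, 1) y) dν(N)` (**definition**: the constant term of `φ` at
  `y` along the block `𝔫_k` of the corner `GL_c ≤ GL_n`, box coordinates) and
  `TowerCusp hc φ` (**definition**: all `blockCT`, `0 < k < c`, vanish for all Haar `ν` and all `y`);
* `towerCusp_of_cuspConditionGL` (**top of the tower**): `CuspConditionGL n K φ k` for all `0 < k < n`
  gives `TowerCusp (le_refl n) φ`.

Not here: the inductive step `TowerCusp (c+1) Φ^{(c+1)} → TowerCusp c Φ^{(c)}` (next file) and the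
identification of the `k = c` case with the hypothesis `hcusp` of the stage identity.

## References

* J. W. Cogdell, in Bernstein–Gelbart (eds.), *An Introduction to the Langlands Program* (2004),
  §1.1 [CogdellAnalyticTheory2004].
* A. Borel, H. Jacquet, Corvallis (1979), §4.4 [BorelJacquet1979].
* J. Tate, in Cassels–Fröhlich (1967), Ch. XV, Lemma 4.2.1 [CasselsFrohlichANT1967].
-/

noncomputable section

open scoped Matrix ComplexConjugate ENNReal Pointwise
open NumberField IsDedekindDomain MeasureTheory Function
open Literature.LinearAlgebra.Matrix

namespace Literature.NumberTheory.Automorphic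

/-! ### Box coordinates of a block -/

section Block

variable {R : Type*} [CommRing R] (m k : ℕ)

/-- The index set of the block `𝔫_k ≤ M_m`: pairs `(i, j)` with `i < k ≤ j`. [folklore] -/
abbrev BlockIdx : Type := {p : Fin m × Fin m // (p.1 : ℕ) < k ∧ k ≤ (p.2 : ℕ)}

variable (R) in
/-- **Box coordinates of the block** `𝔫_k`: the additive isomorphism from functions on `BlockIdx m k`
onto `blockNilpotent m k R` (the entries in the block; zero outside). [folklore] -/
def blockMatrixEquiv : (BlockIdx m k → R) ≃+ blockNilpotent m k R where
  toFun N := ⟨Matrix.of fun i j => if h : (i : ℕ) < k ∧ k ≤ (j : ℕ) then N ⟨(i, j), h⟩ else 0,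
    fun i j hij => by
      by_contra hn
      exact hij (by simp only [Matrix.of_apply, dif_neg hn])⟩
  invFun X p := (X : Matrix (Fin m) (Fin m) R) p.1.1 p.1.2
  left_inv N := by
    funext p
    obtain ⟨⟨i, j⟩, h⟩ := p
    simp only [Matrix.of_apply, dif_pos h]
  right_inv X := by
    refine Subtype.ext (Matrix.ext fun i j => ?_)
    simp only [Matrix.of_apply]
    by_cases h : (i : ℕ) < k ∧ k ≤ (j : ℕ)
    · rw [dif_pos h]
    · rw [dif_neg h]
      exact (apply_eq_zero_of_mem_blockNilpotent X.2 h).symm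
  map_add' N N' := by
    refine Subtype.ext (Matrix.ext fun i j => ?_)
    simp only [Matrix.of_apply, Pi.add_apply, AddSubgroup.coe_add, Matrix.add_apply]
    split_ifs <;> simp

/-- Entries of the block matrix of box coordinates. [folklore] -/
theorem coe_blockMatrixEquiv_apply (N : BlockIdx m k → R) (i j : Fin m) :
    ((blockMatrixEquiv R m k N : blockNilpotent m k R) : Matrix (Fin m) (Fin m) R) i j =
      if h : (i : ℕ) < k ∧ k ≤ (j : ℕ) then N ⟨(i, j), h⟩ else 0 :=
  rfl

/-- The inverse reads off the block entries (definitional). [folklore] -/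
theorem blockMatrixEquiv_symm_apply (X : blockNilpotent m k R) (p : BlockIdx m k) :
    (blockMatrixEquiv R m k).symm X p = (X : Matrix (Fin m) (Fin m) R) p.1.1 p.1.2 :=
  rfl

variable [TopologicalSpace R]

/-- The box-coordinate map is continuous. [folklore] -/
theorem continuous_blockMatrixEquiv : Continuous (blockMatrixEquiv R m k) := by
  refine Continuous.subtype_mk ?_ _
  refine continuous_matrix fun i j => ?_
  simp only [Matrix.of_apply]
  split_ifs
  · exact continuous_apply _
  · exact continuous_const

/-- Its inverse is continuous (matrix entries). [folklore] -/
theorem continuous_blockMatrixEquiv_symm : Continuous (blockMatrixEquiv R m k).symm := by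
  refine continuous_pi fun p => ?_
  exact Continuous.matrix_elem continuous_subtype_val _ _

variable (R) in
/-- The box coordinates as a homeomorphism. [folklore] -/
def blockMatrixHomeomorph : (BlockIdx m k → R) ≃ₜ blockNilpotent m k R where
  toEquiv := (blockMatrixEquiv R m k).toEquiv
  continuous_toFun := continuous_blockMatrixEquiv m k
  continuous_invFun := continuous_blockMatrixEquiv_symm m k

/-- The homeomorphism is the additive equivalence as a map (definitional). [folklore] -/
@[simp]
theorem coe_blockMatrixHomeomorph : ⇑(blockMatrixHomeomorph R m k) = blockMatrixEquiv R m k := rfl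

end Block

/-! ### `diag(g, 1_0) = g` -/

section Corner

variable {R : Type*} [CommRing R] {n : ℕ}

/-- The corner embedding for `m = n` is the identity: `glCorner R (le_refl n) g = g`. [folklore] -/
theorem glCorner_refl (g : GL (Fin n) R) : glCorner R (le_refl n) g = g := by
  refine Units.ext (Matrix.ext fun i j => ?_)
  rw [glCorner_apply_val, dif_pos i.isLt, dif_pos j.isLt]

end Corner

/-! ### Lattices, Haar measures and fundamental domains in box coordinates -/

section Adelic

variable (K : Type) [Field K] [NumberField K] (m k : ℕ)

variable {K m k} in
/-- **Box coordinates match the lattices**: the block matrix of `N` lies in `𝔫_k(K)` iff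
`N ∈ K^{BlockIdx}`. [folklore] -/
theorem blockMatrixEquiv_mem_rationalBlock_iff (N : BlockIdx m k → AdeleRing (𝓞 K) K) :
    blockMatrixEquiv (AdeleRing (𝓞 K) K) m k N ∈ rationalBlock m k K ↔
      N ∈ piPrincipalSubgroup K (BlockIdx m k) := by
  rw [mem_rationalBlock_iff, mem_piPrincipalSubgroup_iff]
  constructor
  · intro h p
    have := h p.1.1 p.1.2
    rwa [coe_blockMatrixEquiv_apply, dif_pos p.2] at this
  · intro h i j
    rw [coe_blockMatrixEquiv_apply]
    split_ifs with hij
    · exact h ⟨(i, j), hij⟩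
    · exact ⟨0, by simp⟩

/-- The induced bijection of lattices `𝔫_k(K) ≃ K^{BlockIdx}`. [folklore] -/
def rationalBlockEquivPiBlock :
    rationalBlock m k K ≃ piPrincipalSubgroup K (BlockIdx m k) where
  toFun γ := ⟨(blockMatrixEquiv (AdeleRing (𝓞 K) K) m k).symm γ, by
    rw [← blockMatrixEquiv_mem_rationalBlock_iff, AddEquiv.apply_symm_apply]; exact γ.2⟩
  invFun ξ := ⟨blockMatrixEquiv (AdeleRing (𝓞 K) K) m k ξ, (blockMatrixEquiv_mem_rationalBlock_iff _).2 ξ.2⟩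
  left_inv γ := Subtype.ext (by simp)
  right_inv ξ := Subtype.ext (by simp)

variable [MeasurableSpace (AdeleRing (𝓞 K) K)] [BorelSpace (AdeleRing (𝓞 K) K)]

variable {K m k} in
/-- The transported measure is an additive Haar measure of `𝔫_k(𝔸_K)`. [folklore] -/
theorem isAddHaarMeasure_map_blockMatrixEquiv (ν : Measure (BlockIdx m k → AdeleRing (𝓞 K) K))
    [ν.IsAddHaarMeasure] :
    (Measure.map (blockMatrixEquiv (AdeleRing (𝓞 K) K) m k) ν :
      Measure (blockNilpotent m k (AdeleRing (𝓞 K) K))).IsAddHaarMeasure := by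
  haveI := t2Space_adeleRing K
  haveI := secondCountableTopology_adeleRing K
  haveI : BorelSpace (BlockIdx m k → AdeleRing (𝓞 K) K) := Pi.borelSpace
  exact AddEquiv.isAddHaarMeasure_map ν (blockMatrixEquiv (AdeleRing (𝓞 K) K) m k)
    (continuous_blockMatrixEquiv m k) (continuous_blockMatrixEquiv_symm m k)

variable {K m k} in
/-- `blockMatrixEquiv` is measure preserving onto the transported measure. [folklore] -/
theorem measurePreserving_blockMatrixEquiv (ν : Measure (BlockIdx m k → AdeleRing (𝓞 K) K)) :
    MeasurePreserving (blockMatrixEquiv (AdeleRing (𝓞 K) K) m k) ν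
      (Measure.map (blockMatrixEquiv (AdeleRing (𝓞 K) K) m k) ν :
        Measure (blockNilpotent m k (AdeleRing (𝓞 K) K))) := by
  haveI := t2Space_adeleRing K
  haveI := secondCountableTopology_adeleRing K
  haveI : BorelSpace (BlockIdx m k → AdeleRing (𝓞 K) K) := Pi.borelSpace
  exact ⟨(continuous_blockMatrixEquiv m k).measurable, rfl⟩

variable {K m k} in
/-- **The image of Tate's box is a fundamental domain of `𝔫_k(K)`** in `𝔫_k(𝔸_K)` for the transported
measure (Mathlib `IsAddFundamentalDomain.image_of_equiv`). [folklore] -/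
theorem isAddFundamentalDomain_image_blockMatrixEquiv (ν : Measure (BlockIdx m k → AdeleRing (𝓞 K) K)) :
    IsAddFundamentalDomain (rationalBlock m k K)
      (blockMatrixEquiv (AdeleRing (𝓞 K) K) m k '' piFundamentalDomain K (BlockIdx m k))
      (Measure.map (blockMatrixEquiv (AdeleRing (𝓞 K) K) m k) ν :
        Measure (blockNilpotent m k (AdeleRing (𝓞 K) K))) := by
  haveI := t2Space_adeleRing K
  haveI := secondCountableTopology_adeleRing K
  haveI : BorelSpace (BlockIdx m k → AdeleRing (𝓞 K) K) := Pi.borelSpace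
  have hD := isAddFundamentalDomain_op_piFundamentalDomain K (BlockIdx m k) ν
  set e : rationalBlock m k K ≃ (piPrincipalSubgroup K (BlockIdx m k)).op :=
    (rationalBlockEquivPiBlock K m k).trans (AddSubgroup.equivOp _) with he
  have hmp := measurePreserving_blockMatrixEquiv (K := K) (m := m) (k := k) ν
  refine hD.image_of_equiv (blockMatrixEquiv (AdeleRing (𝓞 K) K) m k).toEquiv ?_ e fun γ v => ?_
  · have hsymm : MeasurePreserving (blockMatrixEquiv (AdeleRing (𝓞 K) K) m k).symm
        (Measure.map (blockMatrixEquiv (AdeleRing (𝓞 K) K) m k) ν) ν :=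
      hmp.symm (blockMatrixHomeomorph (AdeleRing (𝓞 K) K) m k).toMeasurableEquiv
    exact hsymm.quasiMeasurePreserving
  · change blockMatrixEquiv (AdeleRing (𝓞 K) K) m k
        (v + ((blockMatrixEquiv (AdeleRing (𝓞 K) K) m k).symm γ : BlockIdx m k → AdeleRing (𝓞 K) K)) =
      (γ : blockNilpotent m k (AdeleRing (𝓞 K) K)) + blockMatrixEquiv (AdeleRing (𝓞 K) K) m k v
    rw [map_add, AddEquiv.apply_symm_apply]
    exact add_comm _ _

/-! ### Translation invariance of box integrals of periodic functions -/

variable {K} in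
/-- **Translations do not change box integrals of periodic functions.** For a finite index type `ι`,
an additive Haar measure `ν` on `𝔸_K^ι`, `s ∈ 𝔸_K^ι` and `F : 𝔸_K^ι → E` continuous and
`K^ι`-periodic, `∫_{D^ι} F(v + s) dν(v) = ∫_{D^ι} F(v) dν(v)` (descent to the compact group
`𝔸_K^ι ⧸ K^ι`, where translation preserves the Haar probability measure; Tate's Lemma 4.2.1 to pass to
and from the box). [cite: CasselsFrohlichANT1967, Ch. XV Lemma 4.2.1] -/
theorem setIntegral_piFundamentalDomain_comp_add {ι : Type} [Fintype ι]
    (ν : Measure (ι → AdeleRing (𝓞 K) K)) [ν.IsAddHaarMeasure] (s : ι → AdeleRing (𝓞 K) K)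
    {E : Type*} [NormedAddCommGroup E] [NormedSpace ℝ E]
    {F : (ι → AdeleRing (𝓞 K) K) → E} (hFc : Continuous F)
    (hF : ∀ (v : ι → AdeleRing (𝓞 K) K) (ξ : ι → K),
      F (v + fun i => algebraMap K (AdeleRing (𝓞 K) K) (ξ i)) = F v) :
    ∫ v in piFundamentalDomain K ι, F (v + s) ∂ν = ∫ v in piFundamentalDomain K ι, F v ∂ν := by
  haveI := locallyCompactSpace_adeleRing' K
  haveI := secondCountableTopology_adeleRing K
  haveI := t2Space_adeleRing K
  haveI : Countable K := NumberField.countable' (K := K)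
  haveI : BorelSpace (ι → AdeleRing (𝓞 K) K) := Pi.borelSpace
  letI : MeasurableSpace ((ι → AdeleRing (𝓞 K) K) ⧸ piPrincipalSubgroup K ι) := borel _
  haveI : BorelSpace ((ι → AdeleRing (𝓞 K) K) ⧸ piPrincipalSubgroup K ι) := ⟨rfl⟩
  have hfin : ν (piFundamentalDomain K ι) ≠ ⊤ :=
    ((measure_mono subset_closure).trans_lt (isCompact_closure_piFundamentalDomain K ι).measure_lt_top).ne
  -- periodicity under the subgroup and the descent of `F`
  have hF' : ∀ (v : ι → AdeleRing (𝓞 K) K) (γ : piPrincipalSubgroup K ι), F (v + γ) = F v := by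
    intro v γ
    obtain ⟨ξ, hξ⟩ := (piPrincipalSubgroupEquiv K ι).surjective γ
    have : (γ : ι → AdeleRing (𝓞 K) K) = fun i => algebraMap K (AdeleRing (𝓞 K) K) (ξ i) := by
      rw [← hξ, coe_piPrincipalSubgroupEquiv]
    rw [this]; exact hF v ξ
  let G : (ι → AdeleRing (𝓞 K) K) ⧸ piPrincipalSubgroup K ι → E :=
    Quotient.lift (s := QuotientAddGroup.leftRel (piPrincipalSubgroup K ι)) F fun a b hab => by
      have h : -a + b ∈ piPrincipalSubgroup K ι := QuotientAddGroup.leftRel_apply.1 hab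
      have h' : F (a + (-a + b)) = F a := hF' a ⟨-a + b, h⟩
      rw [add_neg_cancel_left] at h'
      exact h'.symm
  have hGmk : ∀ v, G (QuotientAddGroup.mk v) = F v := fun v => rfl
  have hGc : Continuous G := by
    rw [(QuotientAddGroup.isQuotientMap_mk (piPrincipalSubgroup K ι)).continuous_iff]; exact hFc
  set μQ : Measure ((ι → AdeleRing (𝓞 K) K) ⧸ piPrincipalSubgroup K ι) := Measure.addHaarMeasure ⊤ with hμQ
  -- translation on the quotient preserves `μQ`
  have htr : MeasurePreserving (fun q => q + QuotientAddGroup.mk s) μQ μQ :=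
    measurePreserving_add_right μQ _
  have h1 : ∫ v in piFundamentalDomain K ι, F (v + s) ∂ν =
      (ν (piFundamentalDomain K ι)).toReal • ∫ q, G (q + QuotientAddGroup.mk s) ∂μQ := by
    have := Literature.Analysis.Fourier.integral_fundamentalDomain_comp_mk ν (isClosed_piPrincipalSubgroup K ι)
      (isAddFundamentalDomain_op_piFundamentalDomain K ι ν) hfin (G := fun q => G (q + QuotientAddGroup.mk s))
      ((hGc.comp (continuous_id.add continuous_const)).aestronglyMeasurable)
    refine Eq.trans (setIntegral_congr_fun (measurableSet_piFundamentalDomain K ι) fun v _ => ?_) this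
    change F (v + s) = G (QuotientAddGroup.mk v + QuotientAddGroup.mk s)
    rw [← QuotientAddGroup.mk_add, hGmk]
  have h2 : ∫ q, G (q + QuotientAddGroup.mk s) ∂μQ = ∫ q, G q ∂μQ := by
    have := integral_map (μ := μQ) htr.measurable.aemeasurable (hGc.aestronglyMeasurable (μ := μQ.map _))
    rw [htr.map_eq] at this
    exact this.symm
  have h3 : ∫ v in piFundamentalDomain K ι, F v ∂ν = (ν (piFundamentalDomain K ι)).toReal • ∫ q, G q ∂μQ :=
    Literature.Analysis.Fourier.integral_fundamentalDomain_comp_mk ν (isClosed_piPrincipalSubgroup K ι)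
      (isAddFundamentalDomain_op_piFundamentalDomain K ι ν) hfin (G := G) hGc.aestronglyMeasurable
  rw [h1, h2, ← h3]

/-! ### Block constant terms in the corner, and the top of the tower -/

variable {K m k} in
omit [BorelSpace (AdeleRing (𝓞 K) K)] in
/-- **The constant term at `y` along the block `𝔫_k` of the corner `GL_c ≤ GL_n`, in box coordinates**:
`blockCT hc k ν φ y = ∫_{D} φ(diag(1 + N, 1_{n-c}) · y) dν(N)`, `N` ranging over Tate's box of
`𝔸_K^{BlockIdx c k}`, `1 + N` the block unipotent `unipotentOfBlock` and `diag(·, 1)` the corner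
`glCorner`. For `c = n` and a Haar `ν` this is the constant term of `CuspConditionGL` in box coordinates
(`towerCusp_of_cuspConditionGL`). [cite: BorelJacquet1979, §4.4] -/
def blockCT {n c : ℕ} (hc : c ≤ n) (k : ℕ) (ν : Measure (BlockIdx c k → AdeleRing (𝓞 K) K))
    (φ : GL (Fin n) (AdeleRing (𝓞 K) K) → ℂ) (y : GL (Fin n) (AdeleRing (𝓞 K) K)) : ℂ :=
  ∫ N in piFundamentalDomain K (BlockIdx c k),
    φ (glCorner (AdeleRing (𝓞 K) K) hc
      (unipotentOfBlock c k (AdeleRing (𝓞 K) K)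
        (Multiplicative.ofAdd (blockMatrixEquiv (AdeleRing (𝓞 K) K) c k N))) * y) ∂ν

variable {K m k} in
omit [BorelSpace (AdeleRing (𝓞 K) K)] in
/-- Unfolding of `blockCT`. [folklore] -/
theorem blockCT_apply {n c : ℕ} (hc : c ≤ n) (k : ℕ) (ν : Measure (BlockIdx c k → AdeleRing (𝓞 K) K))
    (φ : GL (Fin n) (AdeleRing (𝓞 K) K) → ℂ) (y : GL (Fin n) (AdeleRing (𝓞 K) K)) :
    blockCT hc k ν φ y = ∫ N in piFundamentalDomain K (BlockIdx c k),
      φ (glCorner (AdeleRing (𝓞 K) K) hc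
        (unipotentOfBlock c k (AdeleRing (𝓞 K) K)
          (Multiplicative.ofAdd (blockMatrixEquiv (AdeleRing (𝓞 K) K) c k N))) * y) ∂ν :=
  rfl

variable {K m k} in
omit [BorelSpace (AdeleRing (𝓞 K) K)] in
/-- **The cusp invariant of the tower at corner size `c`**: all block constant terms of `φ` along the
blocks `𝔫_k`, `0 < k < c`, of the corner `GL_c ≤ GL_n` vanish, at every point and for every additive
Haar measure on the box coordinates (Cogdell (2004), proof of Thm. 1.1: the coefficient `φ_e` is again
"cuspidal along the unipotent radicals inside the mirabolic"). [cite: CogdellAnalyticTheory2004, §1.1] -/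
def TowerCusp {n c : ℕ} (hc : c ≤ n) (φ : GL (Fin n) (AdeleRing (𝓞 K) K) → ℂ) : Prop :=
  ∀ k, 0 < k → k < c → ∀ (ν : Measure (BlockIdx c k → AdeleRing (𝓞 K) K)), ν.IsAddHaarMeasure →
    ∀ y : GL (Fin n) (AdeleRing (𝓞 K) K), blockCT hc k ν φ y = 0

variable {K m k} in
/-- **Top of the tower**: a function satisfying the tree's cusp conditions `CuspConditionGL n K φ k`
for all `0 < k < n` (e.g. `invQuot` of a continuous cusp form, `cuspConditionGL_invQuot_iff_holds`)
satisfies `TowerCusp (le_refl n) φ`: transport the condition along the box coordinates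
`blockMatrixEquiv` (transported Haar measure and fundamental domain) and remove the trivial corner
`glCorner (le_refl n) = id`. [cite: BorelJacquet1979, §4.4] -/
theorem towerCusp_of_cuspConditionGL {n : ℕ} {φ : GL (Fin n) (AdeleRing (𝓞 K) K) → ℂ}
    (hφ : ∀ k, 0 < k → k < n → CuspConditionGL n K φ k) : TowerCusp (le_refl n) φ := by
  intro k hk hkn ν hν y
  haveI := hν
  haveI := t2Space_adeleRing K
  haveI := secondCountableTopology_adeleRing K
  haveI : BorelSpace (BlockIdx n k → AdeleRing (𝓞 K) K) := Pi.borelSpace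
  haveI := isAddHaarMeasure_map_blockMatrixEquiv (K := K) (m := n) (k := k) ν
  have h0 := (hφ k hk hkn (Measure.map (blockMatrixEquiv (AdeleRing (𝓞 K) K) n k) ν)
    (blockMatrixEquiv (AdeleRing (𝓞 K) K) n k '' piFundamentalDomain K (BlockIdx n k))
    (isAddFundamentalDomain_image_blockMatrixEquiv ν) y).2
  have hme : MeasurableEmbedding (blockMatrixEquiv (AdeleRing (𝓞 K) K) n k) :=
    (blockMatrixHomeomorph (AdeleRing (𝓞 K) K) n k).measurableEmbedding
  rw [(measurePreserving_blockMatrixEquiv (K := K) ν).setIntegral_image_emb hme] at h0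
  rw [blockCT_apply]
  simp_rw [glCorner_refl]
  exact h0

end Adelic

end Literature.NumberTheory.Automorphic
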